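import Summits.HodgeConjecture.HodgeConjecture.Theorems.Ring2AbelianAllOneTensorWeilClassCarrierDefs
import Summits.HodgeConjecture.HodgeConjecture.Theorems.Ring2AbelianAllSplitWeilClassesDefs
import HarnessLib

/-!
# Ring 2 / AbelianAll (André column) — the node «ONE CARRIED `E`-WEIL CLASS AT ONE SPLIT ANCHOR OF OUR CHOICE PER TYPE `(E, p)`» (definitions only)

research route, not a corollary; conditional on HC_CM plus one named minimal statement.

DEFINITIONS ONLY (nothing asserted, nothing proved; `HC_CM` absent). PART AF. The per-cell nodes of PART AD-II ∕ AE-II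
(`OneTensorWeilHodgeClassCarriersAt 𝒪 Y₀ n p`, `…TwistedCarriersAt Y₀ n p`) ask ONE carried class at EVERY tensor structure over the anchor variety `Y₀`
(every polarised `X ≅ A₀` isogenous to a power of `Y₀`, every CM-field structure `ψ₀` with a Hodge witness, every polarisation) — because André's COMPACT
pencil delivers its special fibre only up to isogeny. The construction in print (Deligne 1982, proof of Thm. 4.8, clause (c); André 1996, proof of Lemme
6.3.3: Landherr + the hermitian symmetric domain of `Res_{E⁺/ℚ} SU(V, φ)`) puts a PRESCRIBED split anchor into the family ON THE NOSE and reaches every split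
`E`-Weil structure of the same type `(R, e₀, p)` up to `E`-isogeny (Literature `Andre1996.andre1996_weilLineFamily_throughSplitAnchor`, statement only), and
the road's ANCHOR ENGINE (`VHCAbelianSchemesRoadWeilLineThroughAnchor`, route-free: local served-fibre lemma + Hodge-locus/Baire + one-class lemma) then needs
ONE carried class at ONE anchor OF OUR CHOICE per type. This file names that node, in the typing of `AndreSplitWeilClasses` (André's `(*)`-data):

* `OneSplitWeilAnchorCarriers 𝒪 R e₀ p` (`@[conjecture]`): THERE IS a split `E`-Weil datum `(X₀, η₀, e', a')` of type `(R, e₀, p)` — `IsWeilTypeCM X₀ η₀ R e₀ p`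
  (`E = ℚ[T]/(R(T²))`, `[E:ℚ] = 2e₀`, `dim_E H¹ = 2p`, `dim X₀ = 2p·e₀`), an `η₀`-compatible hyperplane class `h₀ = e'^*a'`, `IsHyperbolicWeilType X₀ η₀ (p·e₀) h₀` —
  and a NON-ZERO RATIONAL class `w₀` of its `E`-Weil line `weilClassesField X₀ η₀ (R(T²)) (2p)` which, at EVERY CHART `(X, ε : X₀.X ≅ X, θ)` with `ε^*θ = c·h₀`
  (`c ∈ ℚˣ`) and `θ` a polarisation class, HAS an `𝒪`-datum modulo the `θ`-ray: `ε^{-1 *} w₀ ∈ carriedClasses 𝒪 (dim X₀) p X θ` (degrees `I ∋ p`, `𝒪`-admissible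
  classes `κ` ON `X` with `κ_p = a·ε^{-1 *}w₀ + c_p·θᵖ`, `a ≠ 0`, `κ_q = c_q·θ^q`). ONE anchor, ONE class, ONE polarisation line — all of our choice.
* `OneSplitWeilAnchorTwistedCarriers R e₀ p` (`@[conjecture]`): the same for the road's twisted door `twistedReflexiveClass C AdmTw`, every `C`.
* `OneSplitWeilAnchorTwistedCarriersAll` (`@[conjecture]`): for every type `(R, e₀, p)` with `p > 1` that is INHABITED by a split `E`-Weil datum,
  `OneSplitWeilAnchorTwistedCarriers R e₀ p` — the André column's `B_min` conjunct of gen 63 (with `CMAlgebraicTwistedCarriers`; rows in the companion leaf).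
* Three argument-free cells: `QuadraticSplitSixfoldAnchorOneTwistedCarrier` (`e₀ = 1`, `p = 3` — PREPRINT-EXPECTED: Markman's semiregular twisted secant
  sheaf on `(J(C) × Ĵ(C))/Ḡ`, arXiv:2502.03415 Thm. 1.4.1, §1.5, Lemma 9.3.11, for every `ℚ(√−d)`; the tree's claim-tagged
  `HodgeTheory.Markman2025_secantQuotientAnchor_twistedCarrier_sixfold` modulo the identification of typings — lane W1's files
  `VHCAbelianSchemesRoadSecantQuotientAnchorCM*`), `QuarticSplitEightfoldAnchorOneTwistedCarrier` (`e₀ = 2`, `p = 2`: codimension-2 Weil classes of split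
  eightfolds with a QUARTIC CM field — the K3-partner habitat; Markman's postponed real-multiplication case, arXiv:2509.23079 §1.1: OPEN, no object in print),
  `QuadraticSplitEightfoldAnchorOneTwistedCarrier` (`e₀ = 1`, `p = 4`: split Weil eightfolds, imaginary quadratic `K` — «the secant variety … is a proper
  subvariety», arXiv:2502.03415 §1.2: OPEN).

LATTICE (companion leaf): each node here is IMPLIED by the corresponding per-cell tensor node of AE-II over any anchor variety (a tensor point is a split
anchor; carry the class the old node carries there) — so `B_min` SHRINKS — and is NOT implied by the Hodge conjecture (it asks for sheaves, not cycles).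
PART AE's no-go constrains the object: no direct sum of line bundles ∕ semi-homogeneous bundles ∕ structure sheaves of abelian subvarieties is such a carrier
at a Weil-type point; the object must be indecomposable with Chern character in the generic Hodge ring of the Weil family (Markman's secant sheaves are).
Every node is OPEN unless marked preprint-expected, NOT in print as typed, a HYPOTHESIS wherever used. References: [cite: Andre1996Motifs, §6.3 b) (*) (p. 32),
proof of Lemme 6.3.3 (p. 33)] [cite: Deligne1982HodgeCycles, §4 proof of Thm. 4.8 (clauses (a)–(c)), Cor. 4.2] [cite: Landherr1936HermitianForms]
[cite: MoonenZarhin1998WeilClasses, §1 (dim_E W_E = 1)] [cite: Markman2025SecantWeil, Thm. 1.4.1, §1.2, §1.5 and Lemma 9.3.11] [cite: Markman2025SecantRealMultiplication, §1.1]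
[cite: Bloch1972Semiregularity, Remark (7.5)] [cite: BuchweitzFlenner2003, §5 Thm. 5.1].
-/

noncomputable section

open CategoryTheory

namespace Summit.HodgeConjecture.HodgeConjecture.Ring2.AbelianAll

-- the cell's namespace repeats the summit name (`Summit.HodgeConjecture.HodgeConjecture…`), as in every `Ring2*` file
set_option linter.dupNamespace false

open Literature.AlgebraicGeometry Literature.AlgebraicGeometry.Motives
open Literature.AlgebraicGeometry.HodgeTheory
open Literature.AlgebraicGeometry.Deligne1982
open Literature.AlgebraicGeometry.VanGeemen1994 (pullbackOne)
open Literature.AlgebraicTopology.SingularHomology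
open Summit.Ventures.HSemireg (ObjClass)

/-- **ONE CARRIED `E`-WEIL CLASS AT ONE SPLIT ANCHOR OF OUR CHOICE, type `(R, e₀, p)`, door `𝒪` (`OneSplitWeilAnchorCarriers 𝒪 R e₀ p`)**: there are a complex
abelian variety `X₀` with `η₀ : X₀ ⟶ X₀` of Weil type relative to `E = ℚ(η₀) ≅ ℚ[T]/(R(T²))` (`[E:ℚ] = 2e₀`, `dim_E H¹ = 2p`: `IsWeilTypeCM X₀ η₀ R e₀ p`), a projective
embedding `e'` and a rational `a' ≠ 0` whose hyperplane class `h₀ = e'^*a'` is `η₀`-compatible (`Q_{h₀}(η₀^*x, y) = −Q_{h₀}(x, η₀^*y)`) and SPLIT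
(`IsHyperbolicWeilType X₀ η₀ (p·e₀) h₀` — André's `(*)`), and a NON-ZERO RATIONAL class `w₀` of the `E`-Weil line `weilClassesField X₀ η₀ (R(T²)) (2p)`, such that at
EVERY CHART `(X, ε : X₀.X ≅ X, θ)` with `ε^*θ = c·h₀` for a rational `c ≠ 0` and `θ` a polarisation class on `X`, the transported class `ε^{-1 *}w₀` HAS an `𝒪`-datum
modulo the `θ`-ray (`∈ carriedClasses 𝒪 (dim X₀) p X θ`: degrees `I ∋ p`, `𝒪`-admissible `κ` ON `X`, `κ_p = a·ε^{-1 *}w₀ + c_p·θᵖ`, `a ≠ 0`, `κ_q = c_q·θ^q`). With the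
door and the family fact `andre1996_weilLineFamily_throughSplitAnchor`: the `E`-Weil line of EVERY split structure of type `(R, e₀, p)` is algebraic
(companion engine). OPEN except where an object is in print (`e₀ = 1`, `p = 3`: Markman's twisted secant sheaves, PREPRINT); NOT implied by the Hodge conjecture;
a HYPOTHESIS wherever used. [cite: Andre1996Motifs, §6.3 b) (*) (p. 32), proof of Lemme 6.3.3 (p. 33)] [cite: Deligne1982HodgeCycles, §4 proof of Thm. 4.8, Cor. 4.2]
[cite: MoonenZarhin1998WeilClasses, §1] [cite: Markman2025SecantWeil, Thm. 1.4.1 and §1.5] [cite: Bloch1972Semiregularity, Remark (7.5)] -/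
@[conjecture] def OneSplitWeilAnchorCarriers (𝒪 : ObjClass) (R : Polynomial ℤ) (e₀ p : ℕ) : Prop :=
  ∃ (X₀ : AbelianVariety ℂ) (η₀ : X₀ ⟶ X₀) (e' : ProjectiveEmbedding X₀.X) (a' : complexBetti (projectiveSpace e'.n ℂ) 2)
    (w₀ : complexBetti X₀.X (2 * p)),
    IsWeilTypeCM X₀ η₀ R e₀ p ∧ IsRationalClass a' ∧ a' ≠ 0 ∧
    (∀ x y : complexBetti X₀.X 1,
      polarizationPairingOne X₀.X (complexBetti.map e'.ι 2 a') (X₀.dim - 1) (pullbackOne X₀ η₀ x) y =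
        -polarizationPairingOne X₀.X (complexBetti.map e'.ι 2 a') (X₀.dim - 1) x (pullbackOne X₀ η₀ y)) ∧
    IsHyperbolicWeilType X₀ η₀ (p * e₀) (complexBetti.map e'.ι 2 a') ∧
    w₀ ∈ weilClassesField X₀ η₀ (R.comp (Polynomial.X ^ 2)) (2 * p) ∧ IsRationalClass w₀ ∧ w₀ ≠ 0 ∧
    ∀ (X : SchemeOver ℂ) (ε : X₀.X ≅ X) (θ : complexBetti X 2) (c : ℚ), c ≠ 0 →
      complexBetti.map ε.hom 2 θ = (c : ℂ) • complexBetti.map e'.ι 2 a' → IsPolarizationClass X₀.dim X θ →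
      complexBetti.map ε.inv (2 * p) w₀ ∈ carriedClasses 𝒪 X₀.dim p X θ

/-- **ONE TWISTED CARRIER AT ONE SPLIT ANCHOR OF OUR CHOICE, type `(R, e₀, p)` (`OneSplitWeilAnchorTwistedCarriers R e₀ p`)**: `OneSplitWeilAnchorCarriers` for the
road's twisted door `twistedReflexiveClass C AdmTw` (`AdmTw := gluableSigmaAdmissible ∨ bfSingleAdmissible`: `B`-twisted admissible bounded complexes of vector
bundles), every Chern character theory `C`. OPEN (preprint-expected at `e₀ = 1`, `p = 3`); a HYPOTHESIS wherever used. [cite: Bloch1972Semiregularity, Remark (7.5)]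
[cite: Markman2025SecantWeil, §1.5, Lemma 9.3.11 and §7.3] [cite: BuchweitzFlenner2003, §5 Thm. 5.1] -/
@[conjecture] def OneSplitWeilAnchorTwistedCarriers (R : Polynomial ℤ) (e₀ p : ℕ) : Prop :=
  ∀ C : ChernCharacterBetti, OneSplitWeilAnchorCarriers (twistedReflexiveClass C
    (fun n X₀ I E => Summit.Ventures.HSemireg.gluableSigmaAdmissible n X₀ I E ∨
      Literature.AlgebraicGeometry.HodgeTheory.bfSingleAdmissible n X₀ I E)) R e₀ p

/-- **ONE TWISTED CARRIER AT ONE SPLIT ANCHOR OF OUR CHOICE FOR EVERY INHABITED TYPE `(R, e₀, p)`, `p > 1` (`OneSplitWeilAnchorTwistedCarriersAll`)** — the André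
column's `B_min` conjunct of gen 63: whenever SOME complex abelian variety `B` carries a split `E`-Weil datum `(η, e, a)` of type `(R, e₀, p)` with `p > 1` (the binders
of `AndreSplitWeilClasses` verbatim), there is ONE split anchor of that type — of our choice, e.g. a tensor point `Y₀^{p/g} ⊗ 𝒪_E`, or for `(e₀, p) = (1, 3)` Markman's
`(J(C) × Ĵ(C))/Ḡ` — carrying ONE non-zero rational `E`-Weil class by an AdmTw-admissible `B`-twisted perfect complex modulo the `θ`-ray at every chart. With K-C, the
door and `andre1996_weilLineFamily_throughSplitAnchor` it yields `AndreSplitWeilClasses` (every CM field), hence — Lemme 6.3.2 being a theorem of the tree — `HC_CM`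
with Kodaira, and `HC_AV` with CM-algebraic carriers (companion leaf). OPEN; NOT implied by the Hodge conjecture; a HYPOTHESIS wherever used.
[cite: Andre1996Motifs, §6.3 b)–c) (pp. 32–33)] [cite: Deligne1982HodgeCycles, §4 proof of Thm. 4.8] [cite: Bloch1972Semiregularity, Remark (7.5)]
[cite: Markman2025SecantWeil, §1.2 and §1.5] -/
@[conjecture] def OneSplitWeilAnchorTwistedCarriersAll : Prop :=
  ∀ (R : Polynomial ℤ) (e₀ p : ℕ), 1 < p →
    ∀ (B : AbelianVariety ℂ) (η : B ⟶ B) (e : ProjectiveEmbedding B.X) (a : complexBetti (projectiveSpace e.n ℂ) 2),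
      IsWeilTypeCM B η R e₀ p → IsRationalClass a → a ≠ 0 →
      (∀ x y : complexBetti B.X 1,
        polarizationPairingOne B.X (complexBetti.map e.ι 2 a) (B.dim - 1) (pullbackOne B η x) y =
          -polarizationPairingOne B.X (complexBetti.map e.ι 2 a) (B.dim - 1) x (pullbackOne B η y)) →
      IsHyperbolicWeilType B η (p * e₀) (complexBetti.map e.ι 2 a) →
        OneSplitWeilAnchorTwistedCarriers R e₀ p

/-! ## The three smallest cells, argument-free -/

/-- **THE `(6,3)` QUADRATIC CELL (`QuadraticSplitSixfoldAnchorOneTwistedCarrier`)**: for every type `(R, 1, 3)` (`E = ℚ(√−d)` imaginary quadratic, `E`-rank 6: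
abelian SIXFOLDS of split Weil type) inhabited by a split datum, ONE split anchor of our choice carries ONE non-zero rational codimension-3 Weil class by a twisted
AdmTw-admissible complex modulo `θ³` at every chart. PREPRINT-EXPECTED: Markman's semiregular `μ_{8d}`-twisted reflexive secant sheaf on `(J(C) × Ĵ(C))/Ḡ`
(arXiv:2502.03415 Thm. 1.4.1, §1.5, Lemma 9.3.11; the tree's claim-tagged `HodgeTheory.Markman2025_secantQuotientAnchor_twistedCarrier_sixfold`, whose anchor is a
tensor point `J(C) ⊗ ℚ(√−d)` by lane W1's `SecantQuotientDatum.exists_isTensorPoint`) — modulo the identification of the two typings (`φ² = −d`, `weilClassesOf`,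
descended structure on the quotient ↔ `IsWeilTypeCM _ _ (X + C d') 1 3`, `weilClassesField`). With K-C, the door and the family fact: the codimension-3 Weil classes
of EVERY split Weil sixfold, every imaginary quadratic field (companion leaf) — in print Markman's Thm. 1.5.1 (preprint). A HYPOTHESIS wherever used.
[cite: Markman2025SecantWeil, Thm. 1.4.1, §1.5, Lemma 9.3.11 and Thm. 1.5.1] [cite: Andre1996Motifs, proof of Lemme 6.3.3 (p. 33)] [cite: Bloch1972Semiregularity, Remark (7.5)] -/
@[conjecture] def QuadraticSplitSixfoldAnchorOneTwistedCarrier : Prop :=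
  ∀ R : Polynomial ℤ,
    ∀ (B : AbelianVariety ℂ) (η : B ⟶ B) (e : ProjectiveEmbedding B.X) (a : complexBetti (projectiveSpace e.n ℂ) 2),
      IsWeilTypeCM B η R 1 3 → IsRationalClass a → a ≠ 0 →
      (∀ x y : complexBetti B.X 1,
        polarizationPairingOne B.X (complexBetti.map e.ι 2 a) (B.dim - 1) (pullbackOne B η x) y =
          -polarizationPairingOne B.X (complexBetti.map e.ι 2 a) (B.dim - 1) x (pullbackOne B η y)) →
      IsHyperbolicWeilType B η (3 * 1) (complexBetti.map e.ι 2 a) →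
        OneSplitWeilAnchorTwistedCarriers R 1 3

/-- **THE `(8,2)` QUARTIC CELL (`QuarticSplitEightfoldAnchorOneTwistedCarrier`)** — the smallest OPEN cell of the column: for every type `(R, 2, 2)` (`E` a QUARTIC
CM field, `E`-rank 4: abelian EIGHTFOLDS, Weil classes in codimension 2) inhabited by a split datum, ONE split anchor of our choice (e.g. `Y₀ ⊗ 𝒪_E`, `Y₀` an abelian
surface; or Markman's real-multiplication anchor `X × X̂`, `dim X = 4`) carries ONE non-zero rational codimension-2 `E`-Weil class by a twisted AdmTw-admissible complex
modulo `θ²` at every chart. With K-C, the door and the family fact: the codimension-2 Weil classes of EVERY split Weil eightfold with multiplication by that quartic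
field — the K3-partner habitat («not known to be algebraic (nor Künneth-algebraic)» for `E⁺ ≠ ℚ`). A FIND-THE-SHEAF problem on ONE eightfold; OPEN: Markman's
`B`-secant sheaves for real multiplication are exhibited but their semiregularity is «not addressed yet»; PART AE: no split ∕ semi-homogeneous ∕ `𝒪_Z`-summand
object qualifies. NOT implied by the Hodge conjecture; a HYPOTHESIS wherever used. [cite: Markman2025SecantRealMultiplication, §1.1] [cite: Andre2026, §4.4.4]
[cite: Andre1996Motifs, proof of Lemme 6.3.3 (p. 33)] [cite: Bloch1972Semiregularity, Remark (7.5)] -/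
@[conjecture] def QuarticSplitEightfoldAnchorOneTwistedCarrier : Prop :=
  ∀ R : Polynomial ℤ,
    ∀ (B : AbelianVariety ℂ) (η : B ⟶ B) (e : ProjectiveEmbedding B.X) (a : complexBetti (projectiveSpace e.n ℂ) 2),
      IsWeilTypeCM B η R 2 2 → IsRationalClass a → a ≠ 0 →
      (∀ x y : complexBetti B.X 1,
        polarizationPairingOne B.X (complexBetti.map e.ι 2 a) (B.dim - 1) (pullbackOne B η x) y =
          -polarizationPairingOne B.X (complexBetti.map e.ι 2 a) (B.dim - 1) x (pullbackOne B η y)) →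
      IsHyperbolicWeilType B η (2 * 2) (complexBetti.map e.ι 2 a) →
        OneSplitWeilAnchorTwistedCarriers R 2 2

/-- **THE `(8,4)` QUADRATIC CELL (`QuadraticSplitEightfoldAnchorOneTwistedCarrier`)**: for every type `(R, 1, 4)` (`E = ℚ(√−d)`, `E`-rank 8: split Weil EIGHTFOLDS,
Weil classes in the middle codimension 4) inhabited by a split datum, ONE split anchor of our choice carries ONE non-zero rational codimension-4 Weil class by a
twisted AdmTw-admissible complex modulo `θ⁴` at every chart. With K-C, the door and the family fact: the Weil ladder's rung R2₈ (`SplitEightfolds`), every `d`.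
OPEN: at `X × X̂` for `X` of dimension 4 «the secant variety … is a proper subvariety» and no semiregular secant object is known (arXiv:2502.03415 §1.2). NOT implied by
the Hodge conjecture; a HYPOTHESIS wherever used. [cite: Markman2025SecantWeil, §1.2] [cite: Andre1996Motifs, proof of Lemme 6.3.3 (p. 33)]
[cite: Deligne1982HodgeCycles, §4 proof of Thm. 4.8] [cite: Bloch1972Semiregularity, Remark (7.5)] -/
@[conjecture] def QuadraticSplitEightfoldAnchorOneTwistedCarrier : Prop :=
  ∀ R : Polynomial ℤ,
    ∀ (B : AbelianVariety ℂ) (η : B ⟶ B) (e : ProjectiveEmbedding B.X) (a : complexBetti (projectiveSpace e.n ℂ) 2),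
      IsWeilTypeCM B η R 1 4 → IsRationalClass a → a ≠ 0 →
      (∀ x y : complexBetti B.X 1,
        polarizationPairingOne B.X (complexBetti.map e.ι 2 a) (B.dim - 1) (pullbackOne B η x) y =
          -polarizationPairingOne B.X (complexBetti.map e.ι 2 a) (B.dim - 1) x (pullbackOne B η y)) →
      IsHyperbolicWeilType B η (4 * 1) (complexBetti.map e.ι 2 a) →
        OneSplitWeilAnchorTwistedCarriers R 1 4

/-! ## §2 (appended) The CHART form of the node: at every chart of the one anchor, SOME non-zero rational `E`-Weil class is carried (`∀∃` instead of `∃∀`)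

The anchor engine (`VHCAbelianSchemesRoadWeilLineThroughAnchor` §1) only needs, AT THE CHART THE FAMILY FACT PRODUCES, SOME non-zero rational class of the anchor's
`E`-Weil space carried modulo the ray — not one class `w₀` serving every chart. The `∀∃` form below is therefore sufficient for every row, is implied by §1's `∃∀`
form (carry `ε^{-1 *}w₀`), and is the form in which the per-cell tensor nodes of PART AE-II (which deliver a possibly chart-dependent class) compare to the new node.
A smaller `B_min` (companion leaf §5). -/

/-- **SOME CARRIED `E`-WEIL CLASS AT EVERY CHART OF ONE SPLIT ANCHOR OF OUR CHOICE, type `(R, e₀, p)`, door `𝒪` (`OneSplitWeilAnchorChartCarriers 𝒪 R e₀ p`)** — the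
`∀∃` form of `OneSplitWeilAnchorCarriers`: there is a split `E`-Weil datum `(X₀, η₀, e', a')` of type `(R, e₀, p)` (André's `(*)`: `IsWeilTypeCM X₀ η₀ R e₀ p`, an
`η₀`-compatible hyperplane class `h₀ = e'^*a'`, `IsHyperbolicWeilType X₀ η₀ (p·e₀) h₀`) such that at EVERY CHART `(X, ε : X₀.X ≅ X, θ)` with `ε^*θ = c·h₀` (`c ∈ ℚˣ`) and `θ` a
polarisation class, SOME non-zero rational class `w` on `X` with `ε^*w` in the `E`-Weil line `weilClassesField X₀ η₀ (R(T²)) (2p)` HAS an `𝒪`-datum modulo the `θ`-ray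
(`w ∈ carriedClasses 𝒪 (dim X₀) p X θ`). Implied by `OneSplitWeilAnchorCarriers 𝒪 R e₀ p`; sufficient for the anchor engine; OPEN except where an object is in print
(`e₀ = 1`, `p = 3`: Markman, PREPRINT); NOT implied by the Hodge conjecture; a HYPOTHESIS wherever used. [cite: Andre1996Motifs, §6.3 b) (*) (p. 32), proof of Lemme 6.3.3 (p. 33)]
[cite: Deligne1982HodgeCycles, §4 proof of Thm. 4.8, Cor. 4.2] [cite: MoonenZarhin1998WeilClasses, §1] [cite: Bloch1972Semiregularity, Remark (7.5)] -/
@[conjecture] def OneSplitWeilAnchorChartCarriers (𝒪 : ObjClass) (R : Polynomial ℤ) (e₀ p : ℕ) : Prop :=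
  ∃ (X₀ : AbelianVariety ℂ) (η₀ : X₀ ⟶ X₀) (e' : ProjectiveEmbedding X₀.X) (a' : complexBetti (projectiveSpace e'.n ℂ) 2),
    IsWeilTypeCM X₀ η₀ R e₀ p ∧ IsRationalClass a' ∧ a' ≠ 0 ∧
    (∀ x y : complexBetti X₀.X 1,
      polarizationPairingOne X₀.X (complexBetti.map e'.ι 2 a') (X₀.dim - 1) (pullbackOne X₀ η₀ x) y =
        -polarizationPairingOne X₀.X (complexBetti.map e'.ι 2 a') (X₀.dim - 1) x (pullbackOne X₀ η₀ y)) ∧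
    IsHyperbolicWeilType X₀ η₀ (p * e₀) (complexBetti.map e'.ι 2 a') ∧
    ∀ (X : SchemeOver ℂ) (ε : X₀.X ≅ X) (θ : complexBetti X 2) (c : ℚ), c ≠ 0 →
      complexBetti.map ε.hom 2 θ = (c : ℂ) • complexBetti.map e'.ι 2 a' → IsPolarizationClass X₀.dim X θ →
      ∃ w : complexBetti X (2 * p), IsRationalClass w ∧ w ≠ 0 ∧
        complexBetti.map ε.hom (2 * p) w ∈ weilClassesField X₀ η₀ (R.comp (Polynomial.X ^ 2)) (2 * p) ∧
        w ∈ carriedClasses 𝒪 X₀.dim p X θ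

/-- **The CHART form for the twisted door (`OneSplitWeilAnchorChartTwistedCarriers R e₀ p`)**: `OneSplitWeilAnchorChartCarriers` for `twistedReflexiveClass C AdmTw`, every `C`.
OPEN (preprint-expected at `e₀ = 1`, `p = 3`); a HYPOTHESIS wherever used. [cite: Bloch1972Semiregularity, Remark (7.5)] [cite: Markman2025SecantWeil, §1.5 and Lemma 9.3.11]
[cite: BuchweitzFlenner2003, §5 Thm. 5.1] -/
@[conjecture] def OneSplitWeilAnchorChartTwistedCarriers (R : Polynomial ℤ) (e₀ p : ℕ) : Prop :=
  ∀ C : ChernCharacterBetti, OneSplitWeilAnchorChartCarriers (twistedReflexiveClass C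
    (fun n X₀ I E => Summit.Ventures.HSemireg.gluableSigmaAdmissible n X₀ I E ∨
      Literature.AlgebraicGeometry.HodgeTheory.bfSingleAdmissible n X₀ I E)) R e₀ p

/-- **The CHART form FOR EVERY INHABITED TYPE `(R, e₀, p)`, `p > 1` (`OneSplitWeilAnchorChartTwistedCarriersAll`)** — the André column's `B_min` conjunct of gen 63 in
`∀∃` form (with `CMAlgebraicTwistedCarriers`; rows in the companion leaf §5): whenever some `B` carries a split `E`-Weil datum of type `(R, e₀, p)` with `p > 1`,
`OneSplitWeilAnchorChartTwistedCarriers R e₀ p`. Implied by `OneSplitWeilAnchorTwistedCarriersAll`. OPEN; NOT implied by the Hodge conjecture; a HYPOTHESIS wherever used.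
[cite: Andre1996Motifs, §6.3 b)–c) (pp. 32–33)] [cite: Deligne1982HodgeCycles, §4 proof of Thm. 4.8] [cite: Bloch1972Semiregularity, Remark (7.5)] -/
@[conjecture] def OneSplitWeilAnchorChartTwistedCarriersAll : Prop :=
  ∀ (R : Polynomial ℤ) (e₀ p : ℕ), 1 < p →
    ∀ (B : AbelianVariety ℂ) (η : B ⟶ B) (e : ProjectiveEmbedding B.X) (a : complexBetti (projectiveSpace e.n ℂ) 2),
      IsWeilTypeCM B η R e₀ p → IsRationalClass a → a ≠ 0 →
      (∀ x y : complexBetti B.X 1,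
        polarizationPairingOne B.X (complexBetti.map e.ι 2 a) (B.dim - 1) (pullbackOne B η x) y =
          -polarizationPairingOne B.X (complexBetti.map e.ι 2 a) (B.dim - 1) x (pullbackOne B η y)) →
      IsHyperbolicWeilType B η (p * e₀) (complexBetti.map e.ι 2 a) →
        OneSplitWeilAnchorChartTwistedCarriers R e₀ p

/-! ## §3 (appended) The node AT ANY DOOR (`𝒪`-generic `∀`-types form) and the quadratic types RE-TYPED PER FIELD (a generator of `ℚ(√−r)` is not content)

Two pieces of bookkeeping that the rows of PART AF asked for inline, now NAMED (nothing asserted; companion leaves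
`Ring2AbelianAllOneSplitWeilAnchorQuadraticField` — route-free — and `Ring2AbelianAllOneSplitWeilAnchorPrime`).

(1) DOOR-GENERIC. §1–§2 hard-wire the road's twisted door `twistedReflexiveClass C AdmTw` of item 19275; the route (rev 22) is now keyed to the PRIMED door
`twistedReflexiveClass C AdmTw′`, `AdmTw′ := gluableSigmaAdmissible ∨ bfSingleAdmissible′` (`bfSingleAdmissible′ := bfSingleAdmissible ∧ I.IsShiftedInitialSegment`;
item 20706, door-slice audit repair). `OneSplitWeilAnchorChartCarriersAll 𝒪` is the `∀`-inhabited-types node for an ARBITRARY object class `𝒪` (the inline hypothesis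
`hall` of the leaf's door-generic rows), so that the André column is read at any door by instantiation.

(2) PER FIELD. For `e₀ = 1` a type is `R = T + r` (`r ≥ 1`): the target's generator `η` has `η² = −r` ON THE NOSE, and the typed node asks the same of the anchor's
`η₀`. Print's one anchor — Markman's secant quotient `(J(C) × Ĵ(C))/Ḡ` at level `d = 4r` — carries `ψ_Y` with `ψ_Y² = −(4r+1)²·4r`: a generator of the SAME field
`ℚ(√−r)`, of ANOTHER type. But the generator is not mathematical content: `(B, m·η, e, a)` is a split datum of type `T + m²r` with the SAME `η`-compatible hyperplane
class, the SAME split frame and the SAME Weil space (van Geemen 4.9; tree: `IsWeilTypeCM.quadratic_nsmul`, `weilClassesOf_nsmul_eq_of_sq`), so the typed node is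
MONOTONE along `r ↦ n²r` and the rows only ever need an anchor with multiplication by SOME order `ℤ[m√−r]` of the target's field. Hence the per-FIELD node
`QuadraticFieldOneSplitWeilAnchorChartCarriers 𝒪 r p := ∃ m ≥ 1, OneSplitWeilAnchorChartCarriers 𝒪 (T + m²r) 1 p` (a genuine invariant of the field: `r` and `n²r`
give equivalent nodes, companion leaf), the field-wise `∀`-types node `OneSplitWeilAnchorFieldChartCarriersAll 𝒪` (quadratic types per field; types with `e₀ ≥ 2`
as in (1) — TODO(general form): per-field re-typing for every CM field via `R ↦ R.scaleRoots m²`, `η ↦ m·η`), and the two quadratic cells per field,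
`QuadraticFieldSplitSixfoldAnchorOneCarrier 𝒪` (`p = 3`: SERVED VERBATIM by print's pinned claim L1″ for `𝒪 = tw C Adm`, every `Adm`, with `m = 2(4r+1)` —
companion leaf) and `QuadraticFieldSplitEightfoldAnchorOneCarrier 𝒪` (`p = 4`, OPEN). [cite: vanGeemen1994HodgeAV, 4.9 and Lemma 5.2 (2)]
[cite: Markman2025SecantWeil, §1.5 (p. 7), Thm. 1.4.1 and Lemma 9.3.11] [cite: Andre1996Motifs, §6.3 b) (*) (p. 32), proof of Lemme 6.3.3 (p. 33)]
[cite: BuchweitzFlenner2003, §5 Thm. 5.1] [cite: Pridham2024Semiregularity, Cor. 2.25 and Rem. 2.26] -/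

/-- **SOME CARRIED `E`-WEIL CLASS AT EVERY CHART OF ONE SPLIT ANCHOR OF OUR CHOICE, FOR EVERY INHABITED TYPE `(R, e₀, p)` WITH `p > 1`, DOOR `𝒪`
(`OneSplitWeilAnchorChartCarriersAll 𝒪`)** — the `𝒪`-GENERIC form of `OneSplitWeilAnchorChartTwistedCarriersAll` (that node is this one at `𝒪 = twistedReflexiveClass C AdmTw`
for every `C`): whenever some `B` carries a split `E`-Weil datum `(η, e, a)` of type `(R, e₀, p)` with `p > 1` (the binders of `AndreSplitWeilClasses` verbatim),
`OneSplitWeilAnchorChartCarriers 𝒪 R e₀ p`. Read at the route's primed door `𝒪 = twistedReflexiveClass C AdmTw′` it is the André column's carrier input at rev 22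
(companion leaf `Ring2AbelianAllOneSplitWeilAnchorPrime`). OPEN for every door of interest; NOT implied by the Hodge conjecture (objects, not cycles); a HYPOTHESIS
wherever used. [cite: Andre1996Motifs, §6.3 b)–c) (pp. 32–33)] [cite: Deligne1982HodgeCycles, §4 proof of Thm. 4.8] [cite: Bloch1972Semiregularity, Remark (7.5)]
[cite: BuchweitzFlenner2003, §5 Thm. 5.1] -/
@[conjecture] def OneSplitWeilAnchorChartCarriersAll (𝒪 : ObjClass) : Prop :=
  ∀ (R : Polynomial ℤ) (e₀ p : ℕ), 1 < p →
    ∀ (B : AbelianVariety ℂ) (η : B ⟶ B) (e : ProjectiveEmbedding B.X) (a : complexBetti (projectiveSpace e.n ℂ) 2),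
      IsWeilTypeCM B η R e₀ p → IsRationalClass a → a ≠ 0 →
      (∀ x y : complexBetti B.X 1,
        polarizationPairingOne B.X (complexBetti.map e.ι 2 a) (B.dim - 1) (pullbackOne B η x) y =
          -polarizationPairingOne B.X (complexBetti.map e.ι 2 a) (B.dim - 1) x (pullbackOne B η y)) →
      IsHyperbolicWeilType B η (p * e₀) (complexBetti.map e.ι 2 a) →
        OneSplitWeilAnchorChartCarriers 𝒪 R e₀ p

/-- **ONE SPLIT ANCHOR WITH MULTIPLICATION BY THE FIELD `ℚ(√−r)`, `E`-rank `2p`, door `𝒪` — PER FIELD, NOT PER GENERATOR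
(`QuadraticFieldOneSplitWeilAnchorChartCarriers 𝒪 r p`)**: for SOME `m ≥ 1`, `OneSplitWeilAnchorChartCarriers 𝒪 (T + m²r) 1 p` — a split anchor `(X₀, η₀, e', a')` with
`η₀² = −m²r` (so `ℚ(η₀) = ℚ(√−r)`; `η₀` generates the order `ℤ[m√−r]`), an `η₀`-compatible hyperplane class, a split frame, and at every chart SOME non-zero rational
class of its Weil line carried modulo the `θ`-ray. Equivalent for `r` and `n²r` (`n ≥ 1`); implied by the typed node at `T + r` (`m = 1`); with the door for `𝒪` and the
family fact it serves EVERY split target of EVERY type `T + n²r` (rescale target and anchor to the common type `T + m²n²r`; companion leaf). At `p = 3` SERVED for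
`𝒪 = twistedReflexiveClass C Adm` by print's pinned claim L1″ (`m = 2(4r+1)`, Markman's level `d = 4r`; PREPRINT); OPEN otherwise; NOT implied by the Hodge conjecture;
a HYPOTHESIS wherever used. [cite: vanGeemen1994HodgeAV, 4.9 and Lemma 5.2 (2)] [cite: Markman2025SecantWeil, §1.5 (p. 7) and Thm. 1.4.1]
[cite: Andre1996Motifs, proof of Lemme 6.3.3 (p. 33)] [cite: Bloch1972Semiregularity, Remark (7.5)] -/
@[conjecture] def QuadraticFieldOneSplitWeilAnchorChartCarriers (𝒪 : ObjClass) (r p : ℕ) : Prop :=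
  ∃ m : ℕ, 0 < m ∧ OneSplitWeilAnchorChartCarriers 𝒪 (Polynomial.X + Polynomial.C ((m ^ 2 * r : ℕ) : ℤ)) 1 p

/-- **THE FIELD-WISE `∀`-TYPES NODE, door `𝒪` (`OneSplitWeilAnchorFieldChartCarriersAll 𝒪`)** — the André column's carrier input (ii) of gen 64: (a) for every
imaginary-quadratic type `(T + r, 1, p)`, `p > 1`, inhabited by a split datum, ONE split anchor with multiplication by the FIELD `ℚ(√−r)` (any generator:
`QuadraticFieldOneSplitWeilAnchorChartCarriers 𝒪 r p`); (b) for every inhabited type `(R, e₀, p)` with `e₀ ≥ 2`, `p > 1`, the typed node `OneSplitWeilAnchorChartCarriers 𝒪 R e₀ p`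
(TODO(general form): per-field re-typing for CM fields of degree `2e₀ ≥ 4`, `R ↦ R.scaleRoots m²`). Implied by `OneSplitWeilAnchorChartCarriersAll 𝒪`; with the door for `𝒪`
and the family fact it yields `AndreSplitWeilClasses`, hence `HC_CM` (Kodaira) and, with CM-algebraic carriers, `HC_AV` (companion leaves). OPEN; conjunct (a) at `p = 3`
SERVED by L1″ for `𝒪 = twistedReflexiveClass C Adm` (PREPRINT); NOT implied by the Hodge conjecture; a HYPOTHESIS wherever used.
[cite: Andre1996Motifs, §6.3 b)–c) (pp. 32–33)] [cite: Deligne1982HodgeCycles, §4 proof of Thm. 4.8] [cite: vanGeemen1994HodgeAV, 4.9] [cite: Markman2025SecantWeil, Thm. 1.4.1 and §1.5]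
[cite: Bloch1972Semiregularity, Remark (7.5)] -/
@[conjecture] def OneSplitWeilAnchorFieldChartCarriersAll (𝒪 : ObjClass) : Prop :=
  (∀ (r p : ℕ), 1 < p →
    ∀ (B : AbelianVariety ℂ) (η : B ⟶ B) (e : ProjectiveEmbedding B.X) (a : complexBetti (projectiveSpace e.n ℂ) 2),
      IsWeilTypeCM B η (Polynomial.X + Polynomial.C (r : ℤ)) 1 p → IsRationalClass a → a ≠ 0 →
      (∀ x y : complexBetti B.X 1,
        polarizationPairingOne B.X (complexBetti.map e.ι 2 a) (B.dim - 1) (pullbackOne B η x) y =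
          -polarizationPairingOne B.X (complexBetti.map e.ι 2 a) (B.dim - 1) x (pullbackOne B η y)) →
      IsHyperbolicWeilType B η (p * 1) (complexBetti.map e.ι 2 a) →
        QuadraticFieldOneSplitWeilAnchorChartCarriers 𝒪 r p) ∧
  (∀ (R : Polynomial ℤ) (e₀ p : ℕ), 1 < e₀ → 1 < p →
    ∀ (B : AbelianVariety ℂ) (η : B ⟶ B) (e : ProjectiveEmbedding B.X) (a : complexBetti (projectiveSpace e.n ℂ) 2),
      IsWeilTypeCM B η R e₀ p → IsRationalClass a → a ≠ 0 →
      (∀ x y : complexBetti B.X 1,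
        polarizationPairingOne B.X (complexBetti.map e.ι 2 a) (B.dim - 1) (pullbackOne B η x) y =
          -polarizationPairingOne B.X (complexBetti.map e.ι 2 a) (B.dim - 1) x (pullbackOne B η y)) →
      IsHyperbolicWeilType B η (p * e₀) (complexBetti.map e.ι 2 a) →
        OneSplitWeilAnchorChartCarriers 𝒪 R e₀ p)

/-- **THE `(6,3)` CELL PER FIELD, door `𝒪` (`QuadraticFieldSplitSixfoldAnchorOneCarrier 𝒪`)**: for every `r ≥ 1`, ONE split abelian SIXFOLD of our choice with multiplication
by `ℚ(√−r)` (any generator) carrying, at every chart, SOME non-zero rational codimension-3 Weil class by an `𝒪`-datum modulo `θ³`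
(`QuadraticFieldOneSplitWeilAnchorChartCarriers 𝒪 r 3`). For `𝒪 = twistedReflexiveClass C Adm` — ANY admissibility `Adm`, in particular the route's `AdmTw′` — it is
print's pinned claim L1″ `HodgeTheory.Markman2025_secantQuotient_twistedCarrier_onJacobian_pinned C Adm` READ VERBATIM (companion leaf: `m = 2(4r+1)`, Markman's
`μ_{8d}`-twisted reflexive secant sheaf on `(J(C) × Ĵ(C))/Ḡ` at level `d = 4r`; PREPRINT, under review). With the door and the family fact: the codimension-3 Weil
classes of EVERY split Weil sixfold, every imaginary quadratic field (in print Markman's Thm. 1.5.1). A HYPOTHESIS wherever used.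
[cite: Markman2025SecantWeil, Thm. 1.4.1, §1.5, Lemma 9.3.11 and Thm. 1.5.1] [cite: Andre1996Motifs, proof of Lemme 6.3.3 (p. 33)] [cite: Bloch1972Semiregularity, Remark (7.5)] -/
@[conjecture] def QuadraticFieldSplitSixfoldAnchorOneCarrier (𝒪 : ObjClass) : Prop :=
  ∀ r : ℕ, 0 < r → QuadraticFieldOneSplitWeilAnchorChartCarriers 𝒪 r 3

/-- **THE `(8,4)` CELL PER FIELD, door `𝒪` (`QuadraticFieldSplitEightfoldAnchorOneCarrier 𝒪`)**: for every `r ≥ 1`, ONE split abelian EIGHTFOLD of our choice with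
multiplication by `ℚ(√−r)` (any generator) carrying, at every chart, SOME non-zero rational codimension-4 Weil class by an `𝒪`-datum modulo `θ⁴`
(`QuadraticFieldOneSplitWeilAnchorChartCarriers 𝒪 r 4`). With the door and the family fact: the Weil ladder's rung R2₈ (`SplitEightfolds`) in André's format, every field.
OPEN (at `X × X̂`, `dim X = 4`, «the secant variety … is a proper subvariety», no semiregular secant object known); NOT implied by the Hodge conjecture; a HYPOTHESIS
wherever used. [cite: Markman2025SecantWeil, §1.2] [cite: Andre1996Motifs, proof of Lemme 6.3.3 (p. 33)] [cite: Deligne1982HodgeCycles, §4 proof of Thm. 4.8]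
[cite: Bloch1972Semiregularity, Remark (7.5)] -/
@[conjecture] def QuadraticFieldSplitEightfoldAnchorOneCarrier (𝒪 : ObjClass) : Prop :=
  ∀ r : ℕ, 0 < r → QuadraticFieldOneSplitWeilAnchorChartCarriers 𝒪 r 4

end Summit.HodgeConjecture.HodgeConjecture.Ring2.AbelianAll

end
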